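import Literature.MathematicalPhysics.QuantumFieldTheory.Balaban1983to89.B9Cor36CinvCubeLocDefectCoreHom
import Literature.MathematicalPhysics.QuantumFieldTheory.Balaban1983to89.B9Cor36CubeTwinsGeometry
import Literature.MathematicalPhysics.QuantumFieldTheory.Balaban1983to89.B9Cor36CinvCubeAtLocCfg
import Literature.MathematicalPhysics.QuantumFieldTheory.Balaban1983to89.Node00.OpsYNablaBridge

/-!
# `Balaban1983to89.B9Cor36CinvAtCubeAssembly` — THE C-JUNCTION OF [B9] (3.95) AT ONE COVER CUBE □, ASSEMBLED FROM THE (3.35) DATUM: the per-cube tuple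
# `(C_□, E_□)` of p21's M5.6 defect edition `B9Thm39CinvAtCoverLargeDefect.cinv_cover_large_defect` with its three binders `hdef`, `hC`, `hEd` DISCHARGED at
# `parS := parSymY`, `Oc □ := χ_□R(u)⁻¹G′_□(Ṽ_□)R(u)χ_□` (p33's letter of record), `C_□ := J1_N R(u)⁻¹(Q′_□G′_□²Q′_□*)⁻¹(Ṽ_□)R(u)1_N J⋆` (E2-1), down to the cube's (3.35)
# datum, a bi-contractive gauge and print's units `c_f = L^k` (sub-row G-B9-LETTERS, module M5.2-E, FILE E2-5b-4 = THE END STATEMENT OF E2; design (β) of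
# `lit-balaban-p21/M52E-DESIGN-p21.md`)

T. Bałaban, *Propagators for lattice gauge theories in a background field*, Commun. Math. Phys. **99** (1985) 389–434
[`Balaban1985BackgroundPropagators`, "B9"]; [4] = T. Bałaban, *Propagators and renormalization transformations for lattice gauge
theories. II*, Commun. Math. Phys. **96** (1984) 223–250 [`Balaban1984PropagatorsII`].

statement-level skeleton of published theorems with citation tags; proofs where landed; nothing here is a claim about the
Yang–Mills mass gap

THE PRINTED LOCUS (verbatim, held `paper:balaban1985-cmp99-background-propagators`, journal page = PDF page + 388).  (3.95) p. 411 l. 5–10 (*«We write it in the same way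
as in (2.82) [4] Q′G′²Q′\*C₀ = I + Σ_□(1 − □̃)Q′G′²Q′\*h_□C_□h_□ + Σ_□ □̃Q′(G′² − G′²_□)Q′\*h_□C_□h_□ + Σ_□[□̃Q′G′²_□Q′\*, h_□]C_□h_□ = I − R»*), l. 12–14 (*«separated at least
by a distance MLʲη … e^{−¼δ₀M}»*); p. 412 l. 31–36; p. 409 l. 1–5 (*«the sequence {Ω_n(□)} satisfies the assumptions of Corollary 3.6. The operators constructed for this
sequence, which we denote by G′_□(U), C_□(U) = (Q′(U)G′²_□(U)Q′\*(U))⁻¹, … satisfy all the inequalities of Theorems 3.1–3.3 correspondingly»*); Cor. 3.6 p. 408 l. 3–14;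
Thm 3.2 (3.48) p. 398; (3.57)–(3.59) pp. 401–402; (3.35)–(3.37) p. 396; [4] (2.79)–(2.85) pp. 237–238, Lemma 2.1 p. 234, (2.46) p. 231.

WHY THIS FILE.  p21's M5.6 defect edition (`cinv_cover_large_defect`, FILE E1-4) proves Theorem 3.9 ⇒ Theorem 3.2 (3.48) for `C(U) = (Q′G′²Q′\*)⁻¹(U)` given, PER COVER
CUBE `□`, a site letter `Oc □`, a block operator `Cl □` and a defect `E □` with: (hdef) `M_h(M_{1_{□̃}}(Q′O_□O_□Q′\*)(U))Cl M_h = M_h² + E`, (hC) the un-localized (3.48) block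
majorant of `(η_S²η_S²)⁻¹•Cl` and (hEd) the defect majorant `κ_E e^{−a_Xδ₀D_sep} e^{−a_Eδ₀d}` — all in the member's currency `(toB6 (geo9K i) Rr Hp, ιB)`.  Module M5.2-E
supplies them from the cube sequence's letters (RULING #5) and the (3.35) datum; its files E2-1 (letter + law), E2-2 (hC transfer), E2-3a (hEd transfer), E2-5a (kernel
comparison), E2-5b-1 (defect core, perturbative `Q′`), E2-5b-2 (the sets `S_□ ⊆ N_□`, twins, plateau, separation `M_h`, agreement) and E2-5b-3 (`C_□`, `Q′_□` at the datum)
each discharge one layer.  THIS FILE KNITS THEM: ★★★ `cinvLoc_tuple_at_datum` — for constants `(M₀, T₀, N₀, a₁, δ, a_X, B₀, κ_E)` depending on `d, L, M₂` only, every member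
above the thresholds with `c_f = L^k`, every cover cube, section `ιB`, bi-contractive gauge `u`, field `U` and (3.35) datum `(A, Q, C, ξ, Λ)` (`U^u = e^{iηA}` on the bonds of
`Q ⊇ NearC(35S_j/8 + 1)`, `‖A‖ ≦ Cξ⁻¹`, `‖η⁻¹∂A‖ ≦ Cξ⁻²`, `ξ ≦ 5S_jη`, `L^{j+1}η ≦ Λξ`, `α₁ = max C (C(1+D₁θ))Λ² ≦ min(a₁, 1/4)`): (hdef) VERBATIM, (hC) at every rate
`0 ≦ b_C ≦ δ` with constant `B₀`, (hEd) at every rate `0 ≦ a_E ≦ δ` with constant `κ_E·e^{−a_X·D_sep}` (`D_sep = M/(2L²)` of FILE 10) — M5.6's shapes with `bbδ₀ := b_C`,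
`a_Xδ₀ := a_X`, `a_Eδ₀ := a_E`.  The `G′_□(Ṽ_□)` input is p33's `B9Cor36GpCubeExtAtV.gp_cube_at_locCfg ∕ hasMajorant_GpVK`; one common rate `δ⋆ = min(9δ_G/10, δ_C)`, (2.61) at
the exponents `1/10, 3/5, 3/4` and the scale transfers of `ℓ², ℓ⁻⁴` by p33's `exists_h261_geoCK ∕ hST_geoCK` at `δ⋆`; `δ := δ⋆/4`, `a_X := (4/5)·L·δ⋆` (`(2/5)δ⋆M_h = a_X·D_sep`).
§1 `hg_of_bicontractive` (`‖u‖, ‖u⁻¹‖ ≦ 1 ⇒` E2-2's `hg`), `etaS_sq_sq_inv_eq` (`(η_S²η_S²)⁻¹ = (η⁴)⁻¹` in print's units, def-Y's `abs_cf_mul_etaS_of_hcfk`).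

HONEST SCOPE / NOT CLAIMED.  (i) `E_□` and the truncation `N_□` are the (R)-DESIGN TERM of GAPS.md G-B9-p21-01 (print's `C_□` is [4] (2.82)'s compression inverse with the
global `Q′`, for which (3.95) is exact; nothing fails as printed).  (ii) DISPLAYED: the (3.35) datum per cube in p33's form (which class cube supplies it — cell erratum N-c5-7 —
is not decided here), the bi-contractive gauge `u` (the datum's, `B9Cor36CubeCutoffs.exists_gauge_fld_of_reg335Cube`), the member thresholds, `c_f = L^k` (def-Y's `MemberY.hcfk`),
`[NormOneClass 𝔸]`, `[Fintype (geo9K i).Site]`.  (iii) NOT SUPPLIED HERE: M5.6's other per-cube binders `hEc` (the `EBlock` of `Oc □` — p33's M5.1b-G′ FILE 7b), the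
localized [2]-difference `hD` (cell GAPS G-B9-05), `IsUnit XY`, `hpar`, `hE`; the knit into `cinv_cover_large_defect` (quantifier bookkeeping over the cubes of a member with
per-cube data) is the assembler's (t2s-1 lineage ∕ the 19200 route).  (iv) NO unitarity of `Ṽ_□ = e^{iηχ̃_□A}·1` is assumed anywhere (E2-5b-1∕3: perturbative `Q′_□`).
Count-neutral; no summit ∕ sub-problem statement is proved; nothing continuum ∕ OS ∕ mass-gap ∕ Clay; NOT a node discharge.  No `sorry`, no `axiom`, no `… : Prop` fact, no
`instance`, no `notation`, no `def`.  NEW file; nothing landed is modified.  Cell `lit-balaban`, seat `lit-balaban-p21` gen 35, 2026-08-28; `--supports stmt-QuantumFields-19200`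
as helper.  Net new unproved facts: 0.

RELATED IN THE TREE, NOT DUPLICATED (searched 2026-08-28: `lean search 'cinvLoc_tuple|tuple_at_datum' --decl` = ∅): p21 E2-1 `B9Cor36CinvCubeLocLetter`, E2-2
`B9Cor36CinvCubeLocLetterMajorant`, E2-3a `B9Cor36CinvCubeLocDefectTransfer`, E2-5a `B9Cor36CubeKernelComparison`, E2-5b-1 `B9Cor36CinvCubeLocDefectCoreHom`, E2-5b-2
`B9Cor36CubeTwinsGeometry`, E2-5b-3 `B9Cor36CinvCubeAtLocCfg`, E1-4 `B9Thm39CinvAtCoverLargeDefect` (the consumer; not imported); p33 `B9Cor36GpCubeExtAtV`, `B9Cor36CubeCutoffs`,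
`B9CubeGeometryInputs`; def-Y `Node00.OpsYNablaBridge` (`abs_cf_mul_etaS_of_hcfk`) — all USED BY NAME; no existing module modified.
-/

noncomputable section

namespace Literature.MathematicalPhysics.QuantumFieldTheory.Balaban1983to89.B9Cor36CinvAtCubeAssembly

open B4PartitionUnity22 (thetaProf D1)
open B6RandomWalk (HasMajorant hasMajorant_mono Ineq261 c1_nonneg)
open B6RandomWalkHom (HasMajorantHom hasMajorantHom_mono)
open B9Thm34Ext (toB6)
open B9Eq352DivFormLetters (conj)
open B9Eq376POneLetters (conjHom)
open B9Eq39Adjoint (R fluct covD)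
open B9Eq360Vprime (norm_R_le_of_unit)
open B6KLevelCensusIndexV1 (KIdx kGeo)
open B6Cover236MultiLevelBlocks (cubes)
open B6Cover236MultiLevelTorusBlocks (hB)
open B6Geom246MultiLevelBox (bset)
open B6GlobalChartV1 (PV boxEquiv)
open B6Ineq2142KLevelV1 (β)
open B9BackgroundsKLevelV1 (shiftsV1)
open B9Eq360DeltaPrimeAY (AfldY)
open B9Eq360DeltaPrimeACubeY (blkCubeY)
open B9CubeLettersOpsL0 (cubeFamY GpCubeY)
open B9CubeLettersBondOpsL0 (BlkCubeY QpCubeY QpsCubeY XCubeY XinvCubeY blkCornerCubeY)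
open B9CubeGeometryInputs (geoCK geoCK_dist_axioms geoCK_len_pos hST_geoCK exists_h261_geoCK N1 RM1)
open B9GeoNormsKLevelV1 (geo9K)
open B9Cor35CinvAtCubeLetters (kernel_rate_mono)
open B9Cor36CutoffField337 (cutFldY)
open B9Cor36CubeCutoffs (SC NearC chiY chiTY locCfgY nine_le_SC)
open B9Cor36GpCubeLocLetter (locLetterY)
open B9Cor36GpCubeExtAtV (GpVK gp_cube_at_locCfg hasMajorant_GpVK)
open B9Cor36CinvCubeLocLetter (cubeBlkInd cinvLocLetterY cinvDefectCoreY cinvLocDefectY hdef_cinvLocLetterY)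
open B9Cor36CinvCubeLocLetterMajorant (hasMajorant_conj_smul_cinvLocLetterY)
open B9Cor36CinvCubeLocDefectTransfer (hasMajorant_conj_cinvLocDefectY)
open B9Cor36CinvCubeLocDefectCoreHom (hasMajorant_conj_locDefectCore_of_hom)
open B9Cor36CubeKernelComparison (hcmp_len4 hcmp_exp)
open B9Cor36CubeTwinsGeometry (twinS nearN val_mem_of_mem_nearN exists_twinS_of_hB_ne_zero exists_nearN_of_hB_ne_zero twinS_subset_nearN
  chiY_eq_one_of_mem_nearN chiBigT_mul_hB abs_hB_le chiY_eq_one_of_not_mem_sdiff chiY_nonneg_le_one Mh_le_dist_of_mem_twinS Mh_le_dist_of_mem_sdiff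
  Mh_eq_DsepT parSymY_agree_of_mem_nearN)
open B9Cor36CinvCubeAtLocCfg (cinv_cube_at_locCfg)
open B9Eq359CubeKernelsAtOne (Cq Cq_nonneg)
open B9Thm37CubeCoverCommutators (cutMulY)
open B9Thm39CinvAtCover (chiBigT DsepT DsepT_nonneg)
open Node00 (SiteY BlkY CfgY GaugeY IBondY toKT gSiteY gaugeY parSymY XY parSymY_isGaugeLawS etaS)
open Node00.OpsYNablaBridge (abs_cf_mul_etaS_of_hcfk)

variable {d ℓ : ℕ} {hd : 1 ≤ d + 1} {hL : Odd (ℓ + 1) ∧ 1 < ℓ + 1} {b₀ b₁ : ℝ}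
variable {𝔸 : Type} [NormedRing 𝔸] [NormedAlgebra ℂ 𝔸] [CompleteSpace 𝔸] [NormOneClass 𝔸]
variable {ι : Type} [Fintype ι] [DecidableEq ι] (b : Module.Basis ι ℝ 𝔸)
variable [∀ i' : KIdx d ℓ hd hL b₀ b₁, Fintype (geo9K i').Site]

/-! ## §1 Bookkeeping -/

omit [NormOneClass 𝔸] [∀ i' : KIdx d ℓ hd hL b₀ b₁, Fintype (geo9K i').Site] in
/-- a bi-contractive gauge acts bi-contractively by the adjoint letter `R`. [cite: Balaban1985BackgroundPropagators, (3.28)–(3.31) p.395, bookkeeping] -/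
theorem hg_of_bicontractive (i : KIdx d ℓ hd hL b₀ b₁) {g : GaugeY 𝔸 i} (hu : ∀ x, ‖(g x : 𝔸)‖ ≤ 1 ∧ ‖(((g x)⁻¹ : 𝔸ˣ) : 𝔸)‖ ≤ 1) :
    ∀ (z : SiteY i) (a : 𝔸), ‖R (gSiteY i g z) a‖ ≤ ‖a‖ ∧ ‖R (gSiteY i g z)⁻¹ a‖ ≤ ‖a‖ := fun z a =>
  ⟨norm_R_le_of_unit _ _ (hu _), norm_R_le_of_unit _ _ ⟨(hu _).2, by rw [inv_inv]; exact (hu _).1⟩⟩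

omit [NormOneClass 𝔸] [∀ i' : KIdx d ℓ hd hL b₀ b₁, Fintype (geo9K i').Site] [Fintype ι] [DecidableEq ι] [NormedAlgebra ℂ 𝔸] [CompleteSpace 𝔸] in
/-- in print's units `c_f = L^k` the reading scale `η_S = (L^k)⁻¹` of M5.6 IS the geometry's `η = |c_f|⁻¹`: `(η_S²·η_S²)⁻¹ = (η⁴)⁻¹`.
[cite: Balaban1984PropagatorsII, (2.1) p.224 («η = L^{−k}»), bookkeeping] -/
theorem etaS_sq_sq_inv_eq (i : KIdx d ℓ hd hL b₀ b₁) (hcfk : i.cf = (((ℓ + 1 : ℕ) : ℝ)) ^ i.k) :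
    (etaS i ^ 2 * etaS i ^ 2)⁻¹ = ((kGeo i).eta ^ 4)⁻¹ := by
  have h := abs_cf_mul_etaS_of_hcfk i hcfk
  have e : etaS i = (kGeo i).eta := by
    show etaS i = |i.cf|⁻¹
    exact eq_inv_of_mul_eq_one_right h
  rw [e]; ring

/-! ## §2 ★★★ The per-cube tuple `(Cl_□, E_□)` of M5.6's defect edition with its three binders `hdef`, `hC`, `hEd`, from the (3.35) datum -/

/-- ★★★ **THE C-JUNCTION OF M5.6 AT ONE COVER CUBE, FROM THE (3.35) DATUM** (the per-cube supplier of `B9Thm39CinvAtCoverLargeDefect.cinv_cover_large_defect`'s binders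
`Cl □ := (C_□)|_ℝ`, `E □ := (E_□)|_ℝ`, `hdef`, `hC`, `hEd` at `parS := parSymY`, `Oc □ := fun _ => locLetterY i □ parSymY u χ_□ Ṽ_□` — p33's letter of record): there are
member thresholds `M₀, T₀, N₀`, Theorem 3.4's `a₁ > 0` and constants `δ, a_X > 0`, `B₀, κ_E ≧ 0` (functions of `d, L` and the basis datum `M₂` only) such that for every member
`i` of the V1 family above the thresholds, in print's units `c_f = L^k`, every cover cube `□`, every section `ιB` of the member's index bonds, every bi-contractive gauge `u`,
field `U` and (3.35) datum `(A, Q, C, ξ, Λ)` with `U^u = e^{iηA}` on the bonds of `Q ⊇ {within 4.375S_j + 1 of the centre}`, `‖A‖ ≦ Cξ⁻¹`, `‖η⁻¹∂A‖ ≦ Cξ⁻²`, `ξ ≦ 5S_jη`,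
`L^{j+1}η ≦ Λξ` and `α₁ := max C (C(1+D₁θ))Λ² ≦ min(a₁, 1/4)`, with `Ṽ_□ := e^{iηχ̃_□A}·1`, `N_□ := nearN i □`, `C_□ := cinvLocLetterY i □ parSymY u Ṽ_□ N_□` and
`E_□ := cinvLocDefectY i □ parSymY u χ_□ Ṽ_□ N_□ h_□`:
(hdef) `M_{h_□}·(M_{1_{□̃}}·(Q′O_□O_□Q′*)(U))·C_□·M_{h_□} = M_{h_□}² + E_□` (E2-1 with E2-5b-2's twins ∕ support ∕ plateau ∕ agreement facts and E2-5b-3's unit);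
(hC) for every `0 ≦ b′ ≦ δ`: `conj b((η_S²η_S²)⁻¹•C_□) ≺ B₀·ℓ(a)⁻⁴·e^{−b′d(a,a′)}` over `(toB6 (geo9K i) Rr H, ιB)` (E2-2 ∘ E2-5b-3 ∘ E2-5a);
(hEd) for every `0 ≦ a′ ≦ δ`: `conj b(E_□) ≺ κ_E·e^{−a_X·D_sep}·e^{−a′d(a,a′)}` (E2-3a ∘ E2-5b-1 ∘ E2-5b-2's separation `M_h ≦ d_□(S_□, ∁N_□)`, `M_h = 2L·D_sep` ∘ E2-5a; the `Q′_□(Ṽ_□)`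
factors perturbatively, the `G′_□(Ṽ_□)` factor by p33's `gp_cube_at_locCfg`).
[cite: Balaban1985BackgroundPropagators, (3.95) p.411, p.412 l.31–36, p.409 l.1–5, Cor. 3.6 p.408, Thm 3.4 p.400, Thm 3.2 (3.48) p.398, (3.57)–(3.59) pp.401–402, (3.35)–(3.37) p.396; Balaban1984PropagatorsII, (2.79)–(2.85) pp.237–238, Lemma 2.1 p.234, (2.46) p.231] -/
theorem cinvLoc_tuple_at_datum (hℓ : 1 ≤ ℓ) {M₂ : ℝ} (hM₂ : 0 ≤ M₂) (hrepr : ∀ (v : 𝔸) (j : ι), |b.repr v j| ≤ M₂ * ‖v‖) :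
    ∃ M₀ T₀ : ℝ, ∃ N₀ : ℕ, ∃ a₁ : ℝ, 0 < a₁ ∧ ∃ δ aX B₀ κE : ℝ, 0 < δ ∧ 0 < aX ∧ 0 ≤ B₀ ∧ 0 ≤ κE ∧
    ∀ (i : KIdx d ℓ hd hL b₀ b₁) (c : ↥(cubes (toKT i).D.toDomains)) (Rr : ℝ) (Hp : Prop),
      M₀ ≤ ((ℓ : ℝ) + 1) * (toKT i).Mh → N₀ + 1 ≤ (toKT i).R * ((ℓ + 1) * (toKT i).Mh) → T₀ ≤ RM1 i → i.cf = (((ℓ + 1 : ℕ) : ℝ)) ^ i.k →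
    ∀ (ιB : BlkY i → IBondY i), (∀ s, β i.hN i.D i.hk (ιB s) = s) →
    ∀ (g : GaugeY 𝔸 i), (∀ x, ‖(g x : 𝔸)‖ ≤ 1 ∧ ‖(((g x)⁻¹ : 𝔸ˣ) : 𝔸)‖ ≤ 1) →
    ∀ (U : CfgY 𝔸 i) (A : AfldY 𝔸 i) (Q : Set (Site (PV d ℓ i.m i.K hd hL) 0)) (C ξ Λ : ℝ),
      0 ≤ C → 0 < ξ → 1 ≤ Λ → ξ ≤ 5 * (SC i c : ℝ) * (kGeo i).eta → LatticeNorms.scaleLen ((ℓ : ℝ) + 1) (kGeo i).eta (c.1.1 + 1) ≤ Λ * ξ →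
      (∀ x : Site (PV d ℓ i.m i.K hd hL) 0, NearC i c (35 * SC i c / 8 + 1) (boxEquiv i.hN x).1 → x ∈ Q) →
      (∀ (κ : Fin (d + 1)) (x : Site (PV d ℓ i.m i.K hd hL) 0), x ∈ Q → x.shift κ ∈ Q → gaugeY i g U κ x = fluct (kGeo i).eta A κ x) →
      (∀ κ, ∀ x ∈ Q, ‖A κ x‖ ≤ C * ξ⁻¹) →
      (∀ μ ν, ∀ x ∈ Q, ‖(((kGeo i).eta : ℂ)⁻¹) • covD (shiftsV1 (PV d ℓ i.m i.K hd hL)) (fun _ _ => (1 : 𝔸ˣ)) μ (A ν) x‖ ≤ C * (ξ ^ 2)⁻¹) →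
      max C (C * (1 + D1 thetaProf)) * Λ ^ 2 ≤ a₁ → max C (C * (1 + D1 thetaProf)) * Λ ^ 2 ≤ 1 / 4 →
      ((cutMulY (𝔸 := 𝔸) (hB i.D c)).restrictScalars ℝ *
            ((cutMulY (𝔸 := 𝔸) (chiBigT i c)).restrictScalars ℝ *
              (XY i (parSymY i) (fun _ => locLetterY i c (parSymY i) g (chiY i c) (locCfgY i c (kGeo i).eta A)) U).restrictScalars ℝ) *
            (cinvLocLetterY i c (parSymY i) g (locCfgY i c (kGeo i).eta A) (nearN i c)).restrictScalars ℝ *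
            (cutMulY (𝔸 := 𝔸) (hB i.D c)).restrictScalars ℝ =
          (cutMulY (𝔸 := 𝔸) (hB i.D c)).restrictScalars ℝ * (cutMulY (𝔸 := 𝔸) (hB i.D c)).restrictScalars ℝ +
            (cinvLocDefectY i c (parSymY i) g (chiY i c) (locCfgY i c (kGeo i).eta A) (nearN i c) (hB i.D c)).restrictScalars ℝ) ∧
      (∀ bC : ℝ, 0 ≤ bC → bC ≤ δ →
        HasMajorant (g := toB6 (geo9K i) Rr Hp) (fun p : BlkY i × ι => ιB p.1)
          (conj b ((etaS i ^ 2 * etaS i ^ 2)⁻¹ • (cinvLocLetterY i c (parSymY i) g (locCfgY i c (kGeo i).eta A) (nearN i c)).restrictScalars ℝ))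
          (fun a a' => B₀ * ((geo9K i).len a ^ 4)⁻¹ * Real.exp (-(bC * (geo9K i).dist a a')))) ∧
      (∀ aE : ℝ, 0 ≤ aE → aE ≤ δ →
        HasMajorant (g := toB6 (geo9K i) Rr Hp) (fun p : BlkY i × ι => ιB p.1)
          (conj b ((cinvLocDefectY i c (parSymY i) g (chiY i c) (locCfgY i c (kGeo i).eta A) (nearN i c) (hB i.D c)).restrictScalars ℝ))
          (fun a a' => κE * Real.exp (-(aX * DsepT i)) * Real.exp (-(aE * (geo9K i).dist a a')))) := by
  classical
  have hSb : 0 ≤ ∑ j, ‖b j‖ := Finset.sum_nonneg fun j _ => norm_nonneg _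
  have hMS : 0 ≤ M₂ * ∑ j, ‖b j‖ := mul_nonneg hM₂ hSb
  -- the two cube-side packages (p33's `G′_□` at the datum, FILE E2-5b-3's `C_□` at the datum)
  obtain ⟨δG, BG, MG, TG, NG, hδG, hBG, aG, haG, BB, hBB, HG⟩ := gp_cube_at_locCfg b d ℓ hℓ M₂ hM₂ hrepr
  obtain ⟨δC, BC, MC, TC, NC, hδC, hBC, aC, haC, HC⟩ := cinv_cube_at_locCfg b d ℓ hℓ M₂ hM₂ hrepr
  -- one rate below both
  set δs : ℝ := min (9 / 10 * δG) δC with hδsdef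
  have hδs : 0 < δs := lt_min (by positivity) hδC
  have hδsG : δs ≤ 9 / 10 * δG := min_le_left _ _
  have hδsC : δs ≤ δC := min_le_right _ _
  obtain ⟨dB, h261⟩ := exists_h261_geoCK d ℓ hδs
  -- constants
  set Λ4 : ℝ := ((ℓ : ℝ) + 1) ^ 4 with hΛ4def
  have hΛ4 : 0 ≤ Λ4 := by positivity
  set κQ : ℝ := M₂ * (∑ j, ‖b j‖) * (1 + Cq d * (1 / 4)) with hκQdef
  have hκQ : 0 ≤ κQ := mul_nonneg hMS (by have := Cq_nonneg d; positivity)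
  set κA : ℝ := (κQ * κQ) * (BB * BB * Λ4 * B6.c1 dB δs (1 - 9 / 10)) * (BC * Λ4 * B6.c1 dB δs (1 - 2 / 5)) with hκAdef
  set κB : ℝ := (κQ * κQ) * (BB * BB * Λ4 * B6.c1 dB δs (1 - 2 / 5)) * (BC * Λ4 * B6.c1 dB δs (1 - 1 / 4)) with hκBdef
  have hc1a : 0 ≤ B6.c1 dB δs (1 - 9 / 10) := c1_nonneg _ _ _
  have hc1b : 0 ≤ B6.c1 dB δs (1 - 2 / 5) := c1_nonneg _ _ _
  have hc1c : 0 ≤ B6.c1 dB δs (1 - 1 / 4) := c1_nonneg _ _ _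
  have hκA : 0 ≤ κA := mul_nonneg (mul_nonneg (mul_nonneg hκQ hκQ) (mul_nonneg (mul_nonneg (mul_nonneg hBB hBB) hΛ4) hc1a))
    (mul_nonneg (mul_nonneg hBC.le hΛ4) hc1b)
  have hκB : 0 ≤ κB := mul_nonneg (mul_nonneg (mul_nonneg hκQ hκQ) (mul_nonneg (mul_nonneg (mul_nonneg hBB hBB) hΛ4) hc1b))
    (mul_nonneg (mul_nonneg hBC.le hΛ4) hc1c)
  set κE : ℝ := (M₂ * ∑ j, ‖b j‖) ^ 2 * (κA + κB) with hκEdef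
  have hκE : 0 ≤ κE := mul_nonneg (sq_nonneg _) (add_nonneg hκA hκB)
  set B₀ : ℝ := (M₂ * ∑ j, ‖b j‖) ^ 2 * BC with hB₀def
  have hB₀ : 0 ≤ B₀ := mul_nonneg (sq_nonneg _) hBC.le
  set aX : ℝ := 4 / 5 * ((ℓ : ℝ) + 1) * δs with haXdef
  have haX : 0 < aX := by positivity
  refine ⟨max MG MC, max (max TG TC) (4 * Real.log ((ℓ : ℝ) + 1) / (9 / 5000 * δs)), max (max NG NC) (N1 d ℓ (9 / 5000 * δs)), min aG aC, lt_min haG haC,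
    δs / 4, aX, B₀, κE, by positivity, haX, hB₀, hκE, ?_⟩
  intro i c Rr Hp hM hN hT hcfk ιB hι g hu U A Q C ξ Λ hC0 hξ hΛ hξS hΛξ hQ hgA hA hdA hα₁ hα4
  -- thresholds
  have hMG : MG ≤ ((ℓ : ℝ) + 1) * (toKT i).Mh := (le_max_left _ _).trans hM
  have hMC : MC ≤ ((ℓ : ℝ) + 1) * (toKT i).Mh := (le_max_right _ _).trans hM
  have hTG : TG ≤ RM1 i := ((le_max_left _ _).trans (le_max_left _ _)).trans hT
  have hTC : TC ≤ RM1 i := ((le_max_right _ _).trans (le_max_left _ _)).trans hT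
  have hTs : 4 * Real.log ((ℓ : ℝ) + 1) / (9 / 5000 * δs) ≤ RM1 i := (le_max_right _ _).trans hT
  have hNG : NG + 1 ≤ (toKT i).R * ((ℓ + 1) * (toKT i).Mh) := le_trans (Nat.succ_le_succ ((le_max_left _ _).trans (le_max_left _ _))) hN
  have hNC : NC + 1 ≤ (toKT i).R * ((ℓ + 1) * (toKT i).Mh) := le_trans (Nat.succ_le_succ ((le_max_right _ _).trans (le_max_left _ _))) hN
  have hNs : N1 d ℓ (9 / 5000 * δs) + 1 ≤ (toKT i).R * ((ℓ + 1) * (toKT i).Mh) := le_trans (Nat.succ_le_succ (le_max_right _ _)) hN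
  set α₁ : ℝ := max C (C * (1 + D1 thetaProf)) * Λ ^ 2 with hα₁def
  have hα₁0 : 0 ≤ α₁ := by rw [hα₁def]; exact mul_nonneg (le_max_of_le_left hC0) (sq_nonneg _)
  set Vt : CfgY 𝔸 i := locCfgY i c (kGeo i).eta A with hVtdef
  have hg := hg_of_bicontractive i hu
  -- the two packages at this member / cube
  obtain ⟨-, -, ⟨hbase, -, -⟩, -, hX, -⟩ := HG i c Rr Hp hMG hNG hTG g U A Q C ξ Λ hC0 hξ hΛ hξS hΛξ hQ hgA hA hdA (hα₁.trans (min_le_left _ _)) hα4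
  have hGV := hasMajorant_GpVK b i c Rr Hp A hbase hX
  obtain ⟨⟨hunit, hCinv⟩, hQ1, hQs1⟩ := HC i c Rr Hp hMC hNC hTC A Q C ξ Λ hC0 hξ hΛ hξS hΛξ hQ hA hdA (hα₁.trans (min_le_right _ _)) hα4
  -- geometry of the cube sequence at the rate `δs`
  obtain ⟨hdnn, htri, hrefl, hsym⟩ := geoCK_dist_axioms i c Rr Hp
  have h261a : Ineq261 dB (toB6 (geoCK i c) Rr Hp) δs (1 - 9 / 10) := h261 i c Rr Hp hNs _ (by norm_num) (by norm_num)
  have h261b : Ineq261 dB (toB6 (geoCK i c) Rr Hp) δs (1 - 2 / 5) := h261 i c Rr Hp hNs _ (by norm_num) (by norm_num)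
  have h261c : Ineq261 dB (toB6 (geoCK i c) Rr Hp) δs (1 - 1 / 4) := h261 i c Rr Hp hNs _ (by norm_num) (by norm_num)
  obtain ⟨-, hST2, -, -, -, hST4⟩ := hST_geoCK i c hδs hTs (1 / 10) (by norm_num)
  -- the inputs of FILE E2-5b-1 at the rate `δs`
  have hG' : HasMajorant (g := toB6 (geoCK i c) Rr Hp) (fun p : SiteY i × ι => blkCubeY i c p.1)
      (conj b (((kGeo i).eta ^ 2) • (GpCubeY i c (parSymY i) Vt).restrictScalars ℝ))
      (fun a a' => BB * (geoCK i c).len a ^ 2 * Real.exp (-(δs * (geoCK i c).dist a a'))) :=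
    hasMajorant_mono (g := toB6 (geoCK i c) Rr Hp) _ hGV fun a a' => kernel_rate_mono hdnn hδsG (mul_nonneg hBB (sq_nonneg _)) a a'
  have hC' : HasMajorant (g := toB6 (geoCK i c) Rr Hp) (fun q : BlkCubeY i c × ι => q.1)
      (conj b ((((kGeo i).eta ^ 4)⁻¹) • (XinvCubeY i c (parSymY i) Vt).restrictScalars ℝ))
      (fun a a' => BC * (geoCK i c).len a ^ (-(4 : ℝ)) * Real.exp (-(δs * (geoCK i c).dist a a'))) :=
    hasMajorant_mono (g := toB6 (geoCK i c) Rr Hp) _ hCinv fun a a' => kernel_rate_mono hdnn hδsC (mul_nonneg hBC.le (Real.rpow_nonneg (geoCK_len_pos i c a).le _)) a a'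
  have hκle : M₂ * (∑ j, ‖b j‖) * (1 + Cq d * α₁) ≤ κQ := by
    rw [hκQdef]
    have h4 : Cq d * α₁ ≤ Cq d * (1 / 4) := mul_le_mul_of_nonneg_left hα4 (Cq_nonneg d)
    exact mul_le_mul_of_nonneg_left (by linarith) hMS
  have hQ2 : HasMajorantHom (g := toB6 (geoCK i c) Rr Hp) (fun p : SiteY i × ι => blkCubeY i c p.1) (fun q : BlkCubeY i c × ι => q.1)
      (conjHom b ((QpCubeY i c (parSymY i) Vt).restrictScalars ℝ)) (fun a a' : BlkCubeY i c => if a = a' then κQ else 0) :=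
    hasMajorantHom_mono (g := toB6 (geoCK i c) Rr Hp) _ _ hQ1 fun a a' => by
      split_ifs
      · exact hκle
      · exact le_rfl
  have hQs2 : HasMajorantHom (g := toB6 (geoCK i c) Rr Hp) (fun q : BlkCubeY i c × ι => q.1) (fun p : SiteY i × ι => blkCubeY i c p.1)
      (conjHom b ((QpsCubeY i c (parSymY i) Vt).restrictScalars ℝ)) (fun a a' : BlkCubeY i c => if a = a' then κQ else 0) :=
    hasMajorantHom_mono (g := toB6 (geoCK i c) Rr Hp) _ _ hQs1 fun a a' => by
      split_ifs
      · exact hκle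
      · exact le_rfl
  -- FILE E2-5b-1: the block majorant of the localized defect core, separations `D_N = D_χ = M_h` (FILE E2-5b-2)
  have hD := hasMajorant_conj_locDefectCore_of_hom b i c (parSymY i) Vt (Rr := Rr) (Hp := Hp) hκQ hQ2 hQs2 hdnn htri hsym dB hδs.le hΛ4 hBB hBC.le
    h261a h261b h261c hST2 hST4 (chiY i c) (fun z => (chiY_nonneg_le_one i c z).1) (fun z => (chiY_nonneg_le_one i c z).2) (Finset.univ \ nearN i c)
    (fun z hz => chiY_eq_one_of_not_mem_sdiff i c hz) (nearN i c) (twinS i c) (DN := ((toKT i).Mh : ℝ)) (Dχ := ((toKT i).Mh : ℝ))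
    (fun a ha y hy => Mh_le_dist_of_mem_twinS i c ha hy) (fun a ha y hy => Mh_le_dist_of_mem_sdiff i c ha hy) hG' hC'
  -- the datum radius covers the agreement radius `3S_j + 2`
  have hQ' : ∀ x : Site (PV d ℓ i.m i.K hd hL) 0, NearC i c (3 * SC i c + 2) (boxEquiv i.hN x).1 → x ∈ Q := fun x hx =>
    hQ x (hx.mono i c (by have := nine_le_SC i c; omega))
  have hτ : Function.Injective ιB := Function.LeftInverse.injective hι
  refine ⟨?_, fun bC hbC0 hbC => ?_, fun aE haE0 haE => ?_⟩
  · -- (hdef): FILE E2-1 with FILE E2-5b-2's located facts and FILE E2-5b-3's unit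
    exact hdef_cinvLocLetterY i c (parSymY_isGaugeLawS i) g U Vt (chiY i c) (hB i.D c) (chiBigT i c) (nearN i c)
      (fun s hs => val_mem_of_mem_nearN i c hs) (fun t ht => exists_nearN_of_hB_ne_zero i c ht) (fun t => chiBigT_mul_hB i c t)
      (fun z hz => chiY_eq_one_of_mem_nearN i c hz) (parSymY_agree_of_mem_nearN i c g U (kGeo i).eta A hQ' hgA) hunit
  · -- (hC): FILE E2-2 ∘ FILE E2-5b-3 ∘ FILE E2-5a
    rw [etaS_sq_sq_inv_eq i hcfk]
    refine hasMajorant_conj_smul_cinvLocLetterY i c (parSymY i) b hM₂ hrepr g hg Vt (nearN i c) (gC := toB6 (geoCK i c) Rr Hp) (gD := toB6 (geo9K i) Rr Hp)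
      (fun s => s) (fun t => ιB t) hτ (fun a a' => by positivity) (fun s _ s' _ hs hs' => ?_) _ hCinv
    have h := hcmp_len4 i c ιB hι (B' := (M₂ * ∑ j, ‖b j‖) ^ 2 * BC) (B₀ := B₀) le_rfl (mul_nonneg (sq_nonneg _) hBC.le) (δ := δC) (b' := bC)
      (hbC.trans ((by linarith : δs / 4 ≤ δs).trans hδsC)) hbC0 s s' hs hs'
    refine le_trans (le_of_eq ?_) h
    ring
  · -- (hEd): FILE E2-3a ∘ FILE E2-5b-1 ∘ FILE E2-5a
    refine hasMajorant_conj_cinvLocDefectY i c (parSymY i) b hM₂ hrepr g hg (chiY i c) Vt (nearN i c) (twinS i c) (hB i.D c) (twinS_subset_nearN i c)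
      (fun t ht => exists_twinS_of_hB_ne_zero i c ht) (fun t => abs_hB_le i c t) (gC := toB6 (geoCK i c) Rr Hp) (fun s => s) (gD := geo9K i)
      (Rr := Rr) (Hp := Hp) (fun t => ιB t) hτ (fun a a'' => by positivity) (fun s hs s' _ hs1 hs1' => ?_) hD
    -- `(M₂Σ‖b‖)²·𝟙_S(s)·(κ_A + κ_B)e^{−(2/5)δs·M_h}·e^{−(δs/4)d_□} ≦ κ_E·e^{−a_X·D_sep}·e^{−a′d}`
    have hMh : 2 / 5 * δs * ((toKT i).Mh : ℝ) = aX * DsepT i := by rw [Mh_eq_DsepT i, haXdef]; ring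
    have hind : (if s ∈ twinS i c then (1 : ℝ) else 0) = 1 := if_pos hs
    have h := hcmp_exp i c ιB hι (κ' := κE * Real.exp (-(aX * DsepT i))) (κ := κE * Real.exp (-(aX * DsepT i))) (ρ := 1 / 4 * δs) (a' := aE) le_rfl
      (mul_nonneg hκE (Real.exp_nonneg _)) (by linarith) haE0 s s' hs1 hs1'
    refine le_trans (le_of_eq ?_) (h.trans (le_of_eq (by ring)))
    rw [hind, ← hMh, hκEdef]
    ring

end Literature.MathematicalPhysics.QuantumFieldTheory.Balaban1983to89.B9Cor36CinvAtCubeAssembly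

end
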